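import Mathlib
import Literature.NumberTheory.GaloisRepresentations.CyclicHerbrandQuotient
import HarnessLib

/-!
# Ambiguous ideal classes of a cyclic extension, I: the Galois action on fractional ideals and
# the count of ambiguous classes as an index

Topic `NumberTheory/NumberFields`; namespace `Literature.NumberTheory.NumberFields.AmbiguousClass`.
Definitions with their API and theorems; everything is **proved** (no named fact).

This is the first part of a formalisation of **Chevalley's ambiguous class number formula** for a
cyclic extension `L/F` of number fields with group `G = ⟨σ⟩`,
`#Cl(L)^G · [L:F] · (E_F : E_F ∩ N_{L/F} L^×) = h(F) · ∏_v e_v · 2^{#ramified real places}`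
(S. Lang, *Cyclotomic Fields I–II*, Ch. 13 §4, Lemma 4.1; G. Gras, *Class Field Theory*, II.6.2.3),
organised on the tree's index form of the cyclic Herbrand quotient
(`Literature.NumberTheory.GaloisRepresentations.Herbrand`, `CyclicHerbrandQuotient.lean`): all
`G`-modules are subgroups of the ambient groups `Lˣ` and
`𝓘_L = (FractionalIdeal (𝓞 L)⁰ L)ˣ`, and "`#Cl(L)^G`" is the index `[z0 σ ⊤ P_L : P_L]`.
It is needed for Honda's criterion `3 ∣ h(ℚ(∛pq))` (`PureCubicClassNumberModThree.lean`).

* `AmbiguousClass.intAut σ`, `fracIdealAut σ`, `mulDistribMulActionFracIdealUnits` — `σ ∈ Gal(L/F)`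
  acting on `𝓞 L`, on `FractionalIdeal (𝓞 L)⁰ L` (Mathlib `FractionalIdeal.ringEquivOfRingEquiv`,
  after identifying the induced automorphism of `L = Frac 𝓞_L` with `σ`,
  `ringEquivOfRingEquiv_intAut`) and on `𝓘_L` (a `MulDistribMulAction`); `mem_smul_fracIdeal_iff`,
  `fracIdealAut_spanSingleton`, `smul_mk0`;
* `toPrincipalIdeal_smul` — `a ↦ (a)` is equivariant; `principals L = P_L` is stable
  (`isStable_principals`);
* `mulEquiv_mk`, `mulEquiv_mk0`, `mulEquiv_intAut_one`, `mulEquiv_intAut_mul` — Mathlib's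
  `ClassGroup.mulEquiv (intAut σ)` is the action on classes: `[I] ↦ [σ • I]`
  (through `ringEquivOfRingEquiv_coeIdeal`, `ringEquivOfRingEquiv_canonicalEquiv`);
* `mk_eq_mk_iff`, `mk_smul_eq_mk_iff` — `[σ • I] = [I] ↔ I ∈ z0 σ ⊤ P_L`;
* **`card_fixed_eq_relIndex`** — if `σ` generates `Gal(L/F)`:
  `#{c ∈ Cl(L) : c fixed by Gal(L/F)} = [z0 σ ⊤ P_L : P_L]`.

## References

* S. Lang, *Cyclotomic Fields I and II*, GTM 121, Springer 1990, Ch. 13 §4, Lemma 4.1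
  (held copy `book:lang1990-cyclotomic-fields-i-ii`, PDF pp. 203–204). [Lang1990]
* G. Gras, *Class Field Theory*, Springer 2003, II.6.2.3.
* N. Childress, *Class Field Theory*, Springer 2009, Ch. 4 §4 (Herbrand quotient). [Childress2009]
-/

noncomputable section

open NumberField FractionalIdeal
open scoped nonZeroDivisors

namespace Literature.NumberTheory.NumberFields.AmbiguousClass

variable {F L : Type*} [Field F] [Field L] [NumberField L] [Algebra F L]

/-- The ring automorphism of `𝓞 L` induced by `σ ∈ Gal(L/F)`. [folklore] -/
abbrev intAut (σ : L ≃ₐ[F] L) : 𝓞 L ≃+* 𝓞 L :=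
  RingOfIntegers.mapRingEquiv σ.toRingEquiv

omit [NumberField L] in
/-- `intAut 1 = id`. [folklore] -/
theorem intAut_one : intAut (1 : L ≃ₐ[F] L) = RingEquiv.refl (𝓞 L) :=
  RingEquiv.ext fun _ => Subtype.ext rfl

omit [NumberField L] in
/-- `intAut (σ τ) = intAut σ ∘ intAut τ`. [folklore] -/
theorem intAut_mul (σ τ : L ≃ₐ[F] L) : intAut (σ * τ) = (intAut τ).trans (intAut σ) :=
  RingEquiv.ext fun _ => Subtype.ext rfl

/-- The extension of `intAut σ` to the fraction field `L` is `σ` itself. [folklore] -/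
theorem ringEquivOfRingEquiv_intAut (σ : L ≃ₐ[F] L) :
    (IsFractionRing.ringEquivOfRingEquiv (intAut σ) : L ≃+* L) = σ.toRingEquiv := by
  apply RingEquiv.ext
  intro x
  have h : (IsFractionRing.ringEquivOfRingEquiv (K := L) (L := L) (intAut σ) : L ≃+* L).toRingHom
      = (σ.toRingEquiv : L ≃+* L).toRingHom := by
    refine IsLocalization.ringHom_ext (𝓞 L)⁰ ?_
    ext a
    simp only [RingHom.coe_comp, RingEquiv.toRingHom_eq_coe, RingHom.coe_coe, Function.comp_apply,
      IsFractionRing.ringEquivOfRingEquiv_algebraMap]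
    rfl
  exact congrArg (fun f : L →+* L => f x) h

/-- `σ ∈ Gal(L/F)` acting on the fractional ideals of `L` (a ring automorphism). [folklore] -/
def fracIdealAut (σ : L ≃ₐ[F] L) :
    FractionalIdeal (𝓞 L)⁰ L ≃+* FractionalIdeal (𝓞 L)⁰ L :=
  FractionalIdeal.ringEquivOfRingEquiv L L (intAut σ)

/-- `fracIdealAut 1 = id`. [folklore] -/
theorem fracIdealAut_one : fracIdealAut (1 : L ≃ₐ[F] L) = RingEquiv.refl _ := by
  rw [fracIdealAut, intAut_one, FractionalIdeal.ringEquivOfRingEquiv_refl]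

/-- `fracIdealAut (σ τ) = fracIdealAut σ ∘ fracIdealAut τ`. [folklore] -/
theorem fracIdealAut_mul (σ τ : L ≃ₐ[F] L) :
    fracIdealAut (σ * τ) = (fracIdealAut τ).trans (fracIdealAut σ) := by
  rw [fracIdealAut, intAut_mul, FractionalIdeal.ringEquivOfRingEquiv_trans L L L]
  rfl

/-- `x ∈ σ(I) ↔ σ⁻¹ x ∈ I`. [folklore] -/
theorem mem_fracIdealAut_iff (σ : L ≃ₐ[F] L) (I : FractionalIdeal (𝓞 L)⁰ L) (x : L) :
    x ∈ fracIdealAut σ I ↔ σ.symm x ∈ I := by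
  have he : ∀ y : L, (IsFractionRing.semilinearEquivOfRingEquiv L L (intAut σ)) y = σ y := by
    intro y
    change (IsFractionRing.ringEquivOfRingEquiv (K := L) (L := L) (intAut σ)) y = σ y
    rw [ringEquivOfRingEquiv_intAut]
    rfl
  rw [fracIdealAut, FractionalIdeal.ringEquivOfRingEquiv_apply]
  change x ∈ Submodule.map _ (I : Submodule (𝓞 L) L) ↔ _
  rw [Submodule.mem_map]
  constructor
  · rintro ⟨y, hy, rfl⟩
    have hy' : y ∈ I := (FractionalIdeal.mem_coe).mp hy
    change σ.symm ((IsFractionRing.semilinearEquivOfRingEquiv L L (intAut σ)) y) ∈ I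
    rwa [he, AlgEquiv.symm_apply_apply]
  · intro hx
    refine ⟨σ.symm x, (FractionalIdeal.mem_coe).mpr hx, ?_⟩
    change (IsFractionRing.semilinearEquivOfRingEquiv L L (intAut σ)) (σ.symm x) = x
    rw [he, AlgEquiv.apply_symm_apply]

/-- `σ((x)) = (σ x)`. [folklore] -/
theorem fracIdealAut_spanSingleton (σ : L ≃ₐ[F] L) (x : L) :
    fracIdealAut σ (spanSingleton (𝓞 L)⁰ x) = spanSingleton (𝓞 L)⁰ (σ x) := by
  rw [fracIdealAut, FractionalIdeal.ringEquivOfRingEquiv_spanSingleton, ringEquivOfRingEquiv_intAut]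
  rfl

/-- The Galois group acts on the group of (invertible) fractional ideals. [folklore] -/
instance mulDistribMulActionFracIdealUnits :
    MulDistribMulAction (L ≃ₐ[F] L) (FractionalIdeal (𝓞 L)⁰ L)ˣ where
  smul σ I := Units.mapEquiv (fracIdealAut σ).toMulEquiv I
  one_smul I := by
    change Units.mapEquiv (fracIdealAut (1 : L ≃ₐ[F] L)).toMulEquiv I = I
    ext1
    rw [Units.coe_mapEquiv, fracIdealAut_one]
    rfl
  mul_smul σ τ I := by
    change Units.mapEquiv (fracIdealAut (σ * τ)).toMulEquiv I =
      Units.mapEquiv (fracIdealAut σ).toMulEquiv (Units.mapEquiv (fracIdealAut τ).toMulEquiv I)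
    ext1
    simp only [Units.coe_mapEquiv, fracIdealAut_mul]
    rfl
  smul_mul σ I J := by
    change Units.mapEquiv _ (I * J) = Units.mapEquiv _ I * Units.mapEquiv _ J
    exact map_mul _ I J
  smul_one σ := by
    change Units.mapEquiv _ 1 = 1
    exact map_one _

/-- The action on `𝓘_L`, as fractional ideals. [folklore] -/
theorem coe_smul_fracIdeal (σ : L ≃ₐ[F] L) (I : (FractionalIdeal (𝓞 L)⁰ L)ˣ) :
    ((σ • I : (FractionalIdeal (𝓞 L)⁰ L)ˣ) : FractionalIdeal (𝓞 L)⁰ L) = fracIdealAut σ I := rfl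

/-- `x ∈ σ • I ↔ σ⁻¹ x ∈ I`. [folklore] -/
theorem mem_smul_fracIdeal_iff (σ : L ≃ₐ[F] L) (I : (FractionalIdeal (𝓞 L)⁰ L)ˣ) (x : L) :
    x ∈ ((σ • I : (FractionalIdeal (𝓞 L)⁰ L)ˣ) : FractionalIdeal (𝓞 L)⁰ L) ↔ σ.symm x ∈ (I : FractionalIdeal (𝓞 L)⁰ L) :=
  mem_fracIdealAut_iff σ I x

/-- `a ↦ (a)` is `Gal(L/F)`-equivariant. [folklore] -/
theorem toPrincipalIdeal_smul (σ : L ≃ₐ[F] L) (a : Lˣ) :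
    toPrincipalIdeal (𝓞 L) L (σ • a) = σ • toPrincipalIdeal (𝓞 L) L a := by
  ext1
  rw [coe_toPrincipalIdeal, coe_smul_fracIdeal, coe_toPrincipalIdeal, fracIdealAut_spanSingleton]
  rfl

/-! ### Transport of integral ideals and the class group -/

section Transport

variable {R S : Type*} [CommRing R] [IsDomain R] [CommRing S] [IsDomain S]
  (K K' : Type*) [Field K] [Field K'] [Algebra R K] [Algebra S K'] [IsFractionRing R K]
  [IsFractionRing S K'] (f : R ≃+* S)

/-- `ringEquivOfRingEquiv` maps the extension of an integral ideal `J` to the extension of `f(J)`.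
[folklore] -/
theorem ringEquivOfRingEquiv_coeIdeal (J : Ideal R) :
    FractionalIdeal.ringEquivOfRingEquiv K K' f (J : FractionalIdeal R⁰ K) =
      ((J.map (f : R →+* S) : Ideal S) : FractionalIdeal S⁰ K') := by
  apply FractionalIdeal.ext
  intro x
  rw [FractionalIdeal.ringEquivOfRingEquiv_apply]
  change x ∈ Submodule.map _ ((J : FractionalIdeal R⁰ K) : Submodule R K) ↔ _
  rw [Submodule.mem_map, FractionalIdeal.mem_coeIdeal]
  constructor
  · rintro ⟨y, hy, rfl⟩
    rw [FractionalIdeal.mem_coe, FractionalIdeal.mem_coeIdeal] at hy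
    obtain ⟨j, hj, rfl⟩ := hy
    refine ⟨f j, Ideal.mem_map_of_mem _ hj, ?_⟩
    change _ = IsFractionRing.ringEquivOfRingEquiv f (algebraMap R K j)
    rw [IsFractionRing.ringEquivOfRingEquiv_algebraMap]
  · rintro ⟨j', hj', rfl⟩
    rw [Ideal.map_comap_of_equiv, Ideal.mem_comap] at hj'
    refine ⟨algebraMap R K (f.symm j'), ?_, ?_⟩
    · rw [FractionalIdeal.mem_coe, FractionalIdeal.mem_coeIdeal]
      exact ⟨_, hj', rfl⟩
    · change IsFractionRing.ringEquivOfRingEquiv f (algebraMap R K (f.symm j')) = _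
      rw [IsFractionRing.ringEquivOfRingEquiv_algebraMap, RingEquiv.apply_symm_apply]

end Transport

omit [NumberField L] in
/-- `σ(J)` is again a nonzero ideal. [folklore] -/
theorem map_mem_nonZeroDivisors (σ : L ≃ₐ[F] L) (J : (Ideal (𝓞 L))⁰) :
    (J : Ideal (𝓞 L)).map (intAut σ : 𝓞 L →+* 𝓞 L) ∈ (Ideal (𝓞 L))⁰ := by
  rw [mem_nonZeroDivisors_iff_ne_zero]
  intro h
  exact nonZeroDivisors.ne_zero J.2
    ((Ideal.map_eq_bot_iff_of_injective (RingEquiv.injective (intAut σ))).mp h)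

/-- The action on (the extension of) an integral ideal. [folklore] -/
theorem smul_mk0 (σ : L ≃ₐ[F] L) (J : (Ideal (𝓞 L))⁰) :
    σ • FractionalIdeal.mk0 L J =
      FractionalIdeal.mk0 L ⟨_, map_mem_nonZeroDivisors σ J⟩ := by
  ext1
  rw [coe_smul_fracIdeal, FractionalIdeal.coe_mk0, FractionalIdeal.coe_mk0, fracIdealAut,
    ringEquivOfRingEquiv_coeIdeal]

/-- `ClassGroup.mulEquiv (intAut σ)` is the action of `σ` on classes: on the class of a fractional
ideal `I` it is the class of `σ • I`. [folklore] -/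
theorem mulEquiv_mk0 (σ : L ≃ₐ[F] L) (J : (Ideal (𝓞 L))⁰) :
    ClassGroup.mulEquiv (intAut σ) (ClassGroup.mk0 J) =
      ClassGroup.mk0 ⟨_, map_mem_nonZeroDivisors σ J⟩ := by
  -- `ClassGroup.mulEquiv` on the class of a fractional ideal over `FractionRing (𝓞 L)`
  have hmk : ∀ I : (FractionalIdeal (𝓞 L)⁰ (FractionRing (𝓞 L)))ˣ,
      ClassGroup.mulEquiv (intAut σ) (ClassGroup.mk (FractionRing (𝓞 L)) I) =
        ClassGroup.mk (FractionRing (𝓞 L)) (Units.mapEquiv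
          (FractionalIdeal.ringEquivOfRingEquiv (FractionRing (𝓞 L)) (FractionRing (𝓞 L))
            (intAut σ)).toMulEquiv I) := fun I => by
    rw [ClassGroup.mulEquiv, MulEquiv.trans_apply, MulEquiv.trans_apply, ClassGroup.equiv_mk,
      MulEquiv.symm_apply_eq, ClassGroup.equiv_mk, QuotientGroup.congr_mk']
    congr 1
    ext1
    simp [FractionalIdeal.canonicalEquiv_self]
  rw [← ClassGroup.mk_mk0 (FractionRing (𝓞 L)) J, hmk, ← ClassGroup.mk_mk0 (FractionRing (𝓞 L))]
  congr 1
  ext1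
  rw [Units.coe_mapEquiv, FractionalIdeal.coe_mk0, FractionalIdeal.coe_mk0]
  exact ringEquivOfRingEquiv_coeIdeal _ _ (intAut σ) J

/-- Hence a class is fixed by `ClassGroup.mulEquiv (intAut σ)` iff for an (equivalently, every)
integral representative `J`, `σ(J)` and `J` have the same class. [folklore] -/
theorem mulEquiv_mk0_eq_self_iff (σ : L ≃ₐ[F] L) (J : (Ideal (𝓞 L))⁰) :
    ClassGroup.mulEquiv (intAut σ) (ClassGroup.mk0 J) = ClassGroup.mk0 J ↔
      ClassGroup.mk L (σ • FractionalIdeal.mk0 L J) = ClassGroup.mk L (FractionalIdeal.mk0 L J) := by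
  rw [mulEquiv_mk0, smul_mk0, ClassGroup.mk_mk0, ClassGroup.mk_mk0]


/-! ### Principal ideals, the ideal-class quotient, and the count of fixed classes -/

open Literature.NumberTheory.GaloisRepresentations

variable (L) in
/-- The principal fractional ideals `P_L ≤ 𝓘_L`. [folklore] -/
abbrev principals : Subgroup (FractionalIdeal (𝓞 L)⁰ L)ˣ :=
  (toPrincipalIdeal (𝓞 L) L).range

/-- `P_L` is `Gal(L/F)`-stable. [folklore] -/
theorem isStable_principals : Herbrand.IsStable (L ≃ₐ[F] L) (principals L) := by
  rintro σ _ ⟨a, rfl⟩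
  exact ⟨σ • a, toPrincipalIdeal_smul σ a⟩

/-- Two fractional ideals have the same class iff they differ by a principal ideal. [folklore] -/
theorem mk_eq_mk_iff (I J : (FractionalIdeal (𝓞 L)⁰ L)ˣ) :
    ClassGroup.mk L I = ClassGroup.mk L J ↔ I⁻¹ * J ∈ principals L := by
  rw [← (ClassGroup.equiv L).injective.eq_iff, ClassGroup.equiv_mk, ClassGroup.equiv_mk,
    FractionalIdeal.canonicalEquiv_self, QuotientGroup.mk'_apply, QuotientGroup.mk'_apply,
    QuotientGroup.eq]
  simp

/-- The class of `I` is fixed by `σ` iff `σ • I / I` is principal, i.e. `I ∈ z0 σ ⊤ P_L`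
("`I` has an ambiguous class"). [folklore] -/
theorem mk_smul_eq_mk_iff (σ : L ≃ₐ[F] L) (I : (FractionalIdeal (𝓞 L)⁰ L)ˣ) :
    ClassGroup.mk L (σ • I) = ClassGroup.mk L I ↔
      I ∈ Herbrand.z0 σ (⊤ : Subgroup (FractionalIdeal (𝓞 L)⁰ L)ˣ) (principals L) := by
  rw [Herbrand.mem_z0, mk_eq_mk_iff, div_eq_mul_inv, mul_comm]
  simp only [Subgroup.mem_top, true_and]
  rw [← inv_mem_iff (H := principals L), mul_inv, inv_inv, mul_comm]

/-- Naturality of `canonicalEquiv` with respect to `ringEquivOfRingEquiv`. [folklore] -/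
theorem ringEquivOfRingEquiv_canonicalEquiv (σ : L ≃ₐ[F] L) (x : FractionalIdeal (𝓞 L)⁰ L) :
    FractionalIdeal.ringEquivOfRingEquiv (FractionRing (𝓞 L)) (FractionRing (𝓞 L)) (intAut σ)
        (FractionalIdeal.canonicalEquiv (𝓞 L)⁰ L (FractionRing (𝓞 L)) x) =
      FractionalIdeal.canonicalEquiv (𝓞 L)⁰ L (FractionRing (𝓞 L)) (fracIdealAut σ x) := by
  -- the two ring maps `L → FractionRing (𝓞 L)`
  set ι : L →+* FractionRing (𝓞 L) := IsLocalization.map (M := (𝓞 L)⁰) (T := (𝓞 L)⁰)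
    (FractionRing (𝓞 L)) (RingHom.id (𝓞 L)) (fun y hy => hy) with hι
  set φK : FractionRing (𝓞 L) ≃+* FractionRing (𝓞 L) :=
    IsFractionRing.ringEquivOfRingEquiv (intAut σ) with hφK
  set φL : L ≃+* L := IsFractionRing.ringEquivOfRingEquiv (intAut σ) with hφL
  have hcomm : φK.toRingHom.comp ι = ι.comp φL.toRingHom := by
    refine IsLocalization.ringHom_ext (𝓞 L)⁰ ?_
    ext a
    simp only [RingHom.coe_comp, RingEquiv.toRingHom_eq_coe, RingHom.coe_coe, Function.comp_apply]
    rw [hφL, IsFractionRing.ringEquivOfRingEquiv_algebraMap, hι, IsLocalization.map_eq,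
      IsLocalization.map_eq, hφK, IsFractionRing.ringEquivOfRingEquiv_algebraMap]
    rfl
  have hcomm' : ∀ w : L, φK (ι w) = ι (φL w) := fun w => congrArg (fun f : L →+* _ => f w) hcomm
  apply FractionalIdeal.ext
  intro y
  rw [FractionalIdeal.ringEquivOfRingEquiv_apply, FractionalIdeal.mem_canonicalEquiv_apply]
  change y ∈ Submodule.map _ ((FractionalIdeal.canonicalEquiv (𝓞 L)⁰ L (FractionRing (𝓞 L)) x :
    FractionalIdeal (𝓞 L)⁰ (FractionRing (𝓞 L))) : Submodule (𝓞 L) (FractionRing (𝓞 L))) ↔ _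
  rw [Submodule.mem_map]
  constructor
  · rintro ⟨z, hz, rfl⟩
    rw [FractionalIdeal.mem_coe, FractionalIdeal.mem_canonicalEquiv_apply] at hz
    obtain ⟨w, hw, rfl⟩ := hz
    refine ⟨φL w, ?_, ?_⟩
    · rw [fracIdealAut, FractionalIdeal.ringEquivOfRingEquiv_apply]
      change φL w ∈ Submodule.map _ (x : Submodule (𝓞 L) L)
      exact Submodule.mem_map_of_mem hw
    · exact (hcomm' w).symm
  · rintro ⟨u, hu, rfl⟩
    rw [fracIdealAut, FractionalIdeal.ringEquivOfRingEquiv_apply] at hu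
    change u ∈ Submodule.map _ (x : Submodule (𝓞 L) L) at hu
    rw [Submodule.mem_map] at hu
    obtain ⟨w, hw, rfl⟩ := hu
    refine ⟨ι w, ?_, hcomm' w⟩
    rw [FractionalIdeal.mem_coe, FractionalIdeal.mem_canonicalEquiv_apply]
    exact ⟨w, hw, rfl⟩

/-- `ClassGroup.mulEquiv (intAut σ)` on the class of any fractional ideal `I` of `L` is the class of
`σ • I`. [folklore] -/
theorem mulEquiv_mk (σ : L ≃ₐ[F] L) (I : (FractionalIdeal (𝓞 L)⁰ L)ˣ) :
    ClassGroup.mulEquiv (intAut σ) (ClassGroup.mk L I) = ClassGroup.mk L (σ • I) := by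
  have hmk : ∀ I' : (FractionalIdeal (𝓞 L)⁰ (FractionRing (𝓞 L)))ˣ,
      ClassGroup.mulEquiv (intAut σ) (ClassGroup.mk (FractionRing (𝓞 L)) I') =
        ClassGroup.mk (FractionRing (𝓞 L)) (Units.mapEquiv
          (FractionalIdeal.ringEquivOfRingEquiv (FractionRing (𝓞 L)) (FractionRing (𝓞 L))
            (intAut σ)).toMulEquiv I') := fun I' => by
    rw [ClassGroup.mulEquiv, MulEquiv.trans_apply, MulEquiv.trans_apply, ClassGroup.equiv_mk,
      MulEquiv.symm_apply_eq, ClassGroup.equiv_mk, QuotientGroup.congr_mk']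
    congr 1
    ext1
    simp [FractionalIdeal.canonicalEquiv_self]
  rw [← ClassGroup.mk_canonicalEquiv L (FractionRing (𝓞 L)) I, hmk,
    ← ClassGroup.mk_canonicalEquiv L (FractionRing (𝓞 L)) (σ • I)]
  congr 1
  ext1
  rw [Units.coe_mapEquiv, Units.coe_map, Units.coe_map, coe_smul_fracIdeal]
  exact ringEquivOfRingEquiv_canonicalEquiv σ (I : FractionalIdeal (𝓞 L)⁰ L)

/-- Functoriality: `ClassGroup.mulEquiv ∘ intAut` is a homomorphism to `MulAut (Cl L)`.
[folklore] -/
theorem mulEquiv_intAut_one :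
    ClassGroup.mulEquiv (intAut (1 : L ≃ₐ[F] L)) = MulEquiv.refl (ClassGroup (𝓞 L)) := by
  refine MulEquiv.ext fun c => ClassGroup.induction L (fun I => ?_) c
  rw [mulEquiv_mk, one_smul, MulEquiv.refl_apply]

/-- Functoriality: composition. [folklore] -/
theorem mulEquiv_intAut_mul (σ τ : L ≃ₐ[F] L) :
    ClassGroup.mulEquiv (intAut (σ * τ)) =
      (ClassGroup.mulEquiv (intAut τ)).trans (ClassGroup.mulEquiv (intAut σ)) := by
  refine MulEquiv.ext fun c => ClassGroup.induction L (fun I => ?_) c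
  rw [mulEquiv_mk, MulEquiv.trans_apply, mulEquiv_mk, mulEquiv_mk, mul_smul]

/-- **The number of ambiguous classes as an index.**  If `σ` generates `Gal(L/F)`, the classes of
`Cl(L)` fixed by the Galois action (`ClassGroup.mulEquiv (intAut τ)`, all `τ`) are in bijection
with `z0 σ ⊤ P_L ⁄ P_L`, so their number is the index `[z0 σ ⊤ P_L : P_L]`. [folklore] -/
theorem card_fixed_eq_relIndex [FiniteDimensional F L] {σ : L ≃ₐ[F] L}
    (hσ : ∀ τ : L ≃ₐ[F] L, τ ∈ Subgroup.zpowers σ) :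
    Nat.card {c : ClassGroup (𝓞 L) // ∀ τ : L ≃ₐ[F] L, ClassGroup.mulEquiv (intAut τ) c = c} =
      (principals L).relIndex
        (Herbrand.z0 σ (⊤ : Subgroup (FractionalIdeal (𝓞 L)⁰ L)ˣ) (principals L)) := by
  classical
  set Z := Herbrand.z0 σ (⊤ : Subgroup (FractionalIdeal (𝓞 L)⁰ L)ˣ) (principals L) with hZ
  -- fixed by all `τ` iff fixed by `σ`
  have hfix : ∀ c : ClassGroup (𝓞 L), (∀ τ : L ≃ₐ[F] L, ClassGroup.mulEquiv (intAut τ) c = c) ↔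
      ClassGroup.mulEquiv (intAut σ) c = c := by
    intro c
    refine ⟨fun h => h σ, fun h τ => ?_⟩
    obtain ⟨k, rfl⟩ := Herbrand.exists_pow_eq_of_forall_mem_zpowers hσ τ
    induction k with
    | zero => rw [pow_zero, mulEquiv_intAut_one, MulEquiv.refl_apply]
    | succ k ih => rw [pow_succ, mulEquiv_intAut_mul, MulEquiv.trans_apply, h, ih]
  -- the fixed classes as a subgroup, the range of `Z → Cl(L)`, `I ↦ [I]`
  set φ : Z →* ClassGroup (𝓞 L) := (ClassGroup.mk L).comp Z.subtype with hφ
  have hker : φ.ker = (principals L).subgroupOf Z := by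
    ext I
    rw [MonoidHom.mem_ker, Subgroup.mem_subgroupOf, hφ, MonoidHom.comp_apply,
      Subgroup.coe_subtype, ← (ClassGroup.mk L).map_one, mk_eq_mk_iff, mul_one, inv_mem_iff]
  have hrange : (φ.range : Set (ClassGroup (𝓞 L))) =
      {c | ∀ τ : L ≃ₐ[F] L, ClassGroup.mulEquiv (intAut τ) c = c} := by
    ext c
    simp only [SetLike.mem_coe, MonoidHom.mem_range, Set.mem_setOf_eq, hfix]
    constructor
    · rintro ⟨I, rfl⟩
      rw [hφ, MonoidHom.comp_apply, Subgroup.coe_subtype, mulEquiv_mk, mk_smul_eq_mk_iff]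
      exact I.2
    · intro hc
      obtain ⟨I, rfl⟩ : ∃ I : (FractionalIdeal (𝓞 L)⁰ L)ˣ, ClassGroup.mk L I = c :=
        ClassGroup.induction L (fun I => ⟨I, rfl⟩) c
      rw [mulEquiv_mk, mk_smul_eq_mk_iff] at hc
      exact ⟨⟨I, hc⟩, rfl⟩
  -- count
  have h1 : Nat.card {c : ClassGroup (𝓞 L) // ∀ τ : L ≃ₐ[F] L,
      ClassGroup.mulEquiv (intAut τ) c = c} = Nat.card φ.range :=
    (Nat.card_congr (Equiv.setCongr hrange)).symm
  rw [h1, ← Nat.card_congr (QuotientGroup.quotientKerEquivRange φ).toEquiv, hker]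
  rfl

end Literature.NumberTheory.NumberFields.AmbiguousClass

end
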